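/-
Copyright (c) 2026 the pub-hodgecm-mathlib formalisation cell (harness21).  Prover seat hodgecm-mathlib-K2E3-p20 (g4), HCML Track B «K2-LIT» (build stream 29),
h413 = `stmt-HodgeConjecture-24833`, line `K2_E3_EllipticInputs`, unit U12 «Characters», socket #11 road (11-SC), letter (SC-an), road HC-14-ell, companion of brick (E4-fin)
★ p857087 ((SC-an) line lead K2E3-p14 (g3) RULINGS #14 (R14-3), `K2/STATUS.md` 2026-09-04T03:22:05Z): THE (E-cpt) ⇒ (E-iso) BRIDGE — a regular element of `𝔲(σ, Φ₂)(K)` with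
COMPACT centraliser in `U(σ, Φ₂)` has NO isotropic eigen-line.  2026-09-04.
-/
import Summits.HodgeConjecture.HodgeConjecture.Theorems.K2E3U2CompactCartanClasses   -- ★ p857087 (this seat): `mem_lieU_two_iff`, `eq_smul_one_add_traceless`, `discr_charpoly_eq_four_mul`, `exists_descent_traceless`; brings the ★ U(1,1) frame
import Literature.NumberTheory.Automorphic.LocalFieldHaarBalls                         -- ★ `LocalFieldHaar.continuous_normAbs`
import Literature.NumberTheory.Automorphic.AddCharConductorExponent                    -- ★ `normAbs_add_le_max`, `normAbs_neg`
import HarnessLib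

/-!
# h413 ∕ Track B «K2-LIT», (SC-an) line, road HC-14-ell, (E4-fin) companion: COMPACT CENTRALISER ⇒ NO ISOTROPIC EIGEN-LINE on `𝔲(σ, Φ₂)(K)`
# (Serre, *Trees* II §1.2–1.3; Labesse–Langlands 1979 §2; Rogawski 1990 §3.6)

Cell `pub/hodgecm-mathlib`, crux H413 = `stmt-HodgeConjecture-24833`, route of record `HCCMUnconditional`; (SC-an) line lead K2E3-p14; THEOREMS ONLY (no `def`, no `instance`,
no `notation`, no named-fact hypothesis, no `sorry`); lane `--supports stmt-HodgeConjecture-24833 --as helper`, count-neutral.  RULING #14 (R14-3): «my letters use (E-cpt)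
`IsCompact {g | g X g⁻¹ = X}`; if file (C) proves the (E-iso)-form, add the (E-cpt ⇒ E-iso) bridge (an isotropic eigen-line gives a non-compact split torus inside `Z(X)`)».

THE MATHEMATICS.  Let `X ∈ 𝔲(σ, Φ₂)` be regular (`δ ≠ 0`), `X = a·1 + Z`, `Z = (x, b; c, −x)`, and suppose `v ≠ 0` is an ISOTROPIC eigenvector: `Z v = λ v`, `σ(v₀)v₁ + σ(v₁)v₀ = 0`.
(1) `λ` IS `σ`-FIXED: if `v₁ = 0` then `c = 0` and `λ = x`; if `v₀ = 0` then `b = 0` and `λ = −x`; otherwise `ρ = v₀∕v₁` is skew (isotropy) and `λ = cρ − x` is fixed (`c` skew).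
(2) `λ² = δ` (`Z² = δ·1`), so `δ = ι(e)²` with `ι e = λ`, `e ≠ 0`.  (3) The descended `W ∈ 𝔰𝔩₂(F)` (★ `exists_descent_traceless`: `diag(1,α) Z diag(1,α⁻¹) = ι W`, `det W = −e²`) is
`GL₂(F)`-conjugate to `diag(e, −e)` (★ cyclic vectors), `h W h⁻¹ = diag(e,−e)`; the determinant-ONE matrices `gₖ = h⁻¹ diag(tᵏ, t⁻ᵏ) h` commute with `W` and LIFT to `uₖ ∈ U(σ, Φ₂)`
(★ `exists_mem_unitaryGroupOfForm_conj_eq_smul_map`), `uₖ = diag(1,α)⁻¹ ι(gₖ) diag(1,α)`, which commute with `Z`, hence with `X`: `uₖ ∈ Z_U(X)`.  (4) `tr uₖ = ι(tᵏ + t⁻ᵏ)` has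
`|tr uₖ| ≥ |ι t|ᵏ` (ultrametric), unbounded if `|ι t| > 1` — contradicting the boundedness of the continuous `g ↦ |tr g|` on the compact `Z_U(X)`.

* §1 `traceless_sq_eq_smul_one` (`Z² = δ·1`), **`eigenvalue_fixed_of_isotropic`** ((1)+(2): `σλ = λ ∧ λ² = δ` for the traceless part).
* §2 **`not_isotropic_eigenvector_of_isCompact_centralizer`** — THE BRIDGE; `exists_fin_compactCartan_representatives_of_isCompact` — ★ (E4-fin)'s head with «elliptic» read as
  (E-cpt) for the INPUT `X` (representatives still certified by (E-iso)).

HONEST LABEL.  HC_CM is proved only modulo the 7 printed citations (2 remaining named inputs: hLiu418 = `stmt-HodgeConjecture-24832`, h413 = `stmt-HodgeConjecture-24833`)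
until rung 0 closes; count-neutral helper (plumbing between the letter's (E-cpt) and the (E4-fin) file's (E-iso)).

## References
* [Serre1980Trees] J.-P. Serre, *Trees* (1980), Ch. II §1.2–§1.3 · [LabesseLanglands1979] J.-P. Labesse, R. P. Langlands, *L-indistinguishability for SL(2)*, Canad. J. Math. 31
  (1979), §2 p. 7 · [Rogawski1990] J. D. Rogawski, *Automorphic Representations of Unitary Groups in Three Variables* (1990), §3.6 p. 31.
-/

set_option autoImplicit false
set_option linter.dupNamespace false  -- the mandated namespace repeats the single-problem summit's segment (`HodgeConjecture.HodgeConjecture`)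

noncomputable section

open Matrix
open scoped MatrixGroups NNReal
open Literature.NumberTheory.Automorphic Literature.NumberTheory.Automorphic.UnitaryGroup
open Literature.NumberTheory.GaloisRepresentations.IsNonarchimedeanLocalField
open Summit.HodgeConjecture.HodgeConjecture.Cruxes.H413.K2E3U2CompactCartanClasses

namespace Summit.HodgeConjecture.HodgeConjecture.Cruxes.H413.K2E3U2CompactCentraliserIsotropic

/-! ## §1 The eigenvalue of an isotropic eigen-line is `σ`-fixed -/

section Algebra

variable {F K : Type*} [Field F] [Field K] (ι : F →+* K) (σ : K →+* K) (hσ : ∀ x, σ (σ x) = x) (hσι : ∀ x : F, σ (ι x) = ι x)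
  (hfix : ∀ z : K, σ z = z → ∃ x : F, ι x = z) {α : K} (hα : σ α = -α) (hα0 : α ≠ 0) (h2 : (2 : K) ≠ 0)

/-- `Z² = δ·1` for the traceless `Z = (x, b; c, −x)`, `δ = x² + bc` (Cayley–Hamilton). [cite: Serre1980Trees, Ch. II §1.2] -/
theorem traceless_sq_mulVec (x b c : K) (v : Fin 2 → K) :
    (!![x, b; c, -x]).mulVec ((!![x, b; c, -x]).mulVec v) = (x ^ 2 + b * c) • v := by
  ext i
  fin_cases i <;> simp [Matrix.mulVec, dotProduct, Fin.sum_univ_two] <;> ring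

include hσ h2 in
/-- **AN ISOTROPIC EIGEN-LINE HAS A `σ`-FIXED EIGENVALUE ON THE TRACELESS PART, AND ITS SQUARE IS `δ`**: for `X ∈ 𝔲(σ, Φ₂)` and an isotropic eigenvector `v ≠ 0` (`X v = μ v`),
`λ := μ − a` (`a = (X₀₀ − σX₀₀)∕2`) satisfies `σ λ = λ` and `λ² = δ`.  (1): three coordinate cases (`v₁ = 0 ⇒ λ = x`; `v₀ = 0 ⇒ λ = −x`; else `λ = c·(v₀∕v₁) − x` with `v₀∕v₁` skew);
(2): `Z² = δ·1`. [cite: Rogawski1990, §3.6 p. 31] [cite: Serre1980Trees, Ch. II §1.2] -/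
theorem eigenvalue_fixed_of_isotropic {X : Matrix (Fin 2) (Fin 2) K} (hX : (X.map σ)ᵀ * !![(0 : K), 1; 1, 0] + !![(0 : K), 1; 1, 0] * X = 0)
    {v : Fin 2 → K} (hv : v ≠ 0) {μ : K} (hμ : X.mulVec v = μ • v) (hiso : σ (v 0) * v 1 + σ (v 1) * v 0 = 0) :
    σ (μ - (X 0 0 - σ (X 0 0)) / 2) = μ - (X 0 0 - σ (X 0 0)) / 2 ∧
      (μ - (X 0 0 - σ (X 0 0)) / 2) ^ 2 = ((X 0 0 + σ (X 0 0)) / 2) ^ 2 + X 0 1 * X 1 0 := by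
  obtain ⟨hc, hb, h3⟩ := (mem_lieU_two_iff σ hσ X).1 hX
  have hXdec := eq_smul_one_add_traceless σ hσ h2 hX
  have hxσ : σ ((X 0 0 + σ (X 0 0)) / 2) = (X 0 0 + σ (X 0 0)) / 2 := map_half_add_eq σ hσ (X 0 0)
  -- the traceless part acts by `λ = μ − a`
  have hZ : (!![(X 0 0 + σ (X 0 0)) / 2, X 0 1; X 1 0, -((X 0 0 + σ (X 0 0)) / 2)]).mulVec v = (μ - (X 0 0 - σ (X 0 0)) / 2) • v := by
    have h1 : X.mulVec v = ((X 0 0 - σ (X 0 0)) / 2) • v + (!![(X 0 0 + σ (X 0 0)) / 2, X 0 1; X 1 0, -((X 0 0 + σ (X 0 0)) / 2)]).mulVec v := by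
      conv_lhs => rw [hXdec]
      rw [Matrix.add_mulVec, Matrix.smul_mulVec, Matrix.one_mulVec]
    rw [sub_smul, ← hμ, h1]; abel
  generalize hx : (X 0 0 + σ (X 0 0)) / 2 = x at hZ hxσ ⊢
  generalize hl : μ - (X 0 0 - σ (X 0 0)) / 2 = lam at hZ ⊢
  have e0 : x * v 0 + X 0 1 * v 1 = lam * v 0 := by
    have := congr_fun hZ 0; simpa [Matrix.mulVec, dotProduct, Fin.sum_univ_two] using this
  have e1 : X 1 0 * v 0 - x * v 1 = lam * v 1 := by
    have := congr_fun hZ 1; simpa [Matrix.mulVec, dotProduct, Fin.sum_univ_two, sub_eq_add_neg] using this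
  refine ⟨?_, ?_⟩
  · by_cases hv1 : v 1 = 0
    · have hv0 : v 0 ≠ 0 := by
        intro h0; apply hv; ext i; fin_cases i <;> simp [h0, hv1]
      have hlam : lam = x := by
        rw [hv1, mul_zero, add_zero] at e0
        exact (mul_right_cancel₀ hv0 e0).symm
      rw [hlam, hxσ]
    · by_cases hv0 : v 0 = 0
      · have hlam : lam = -x := by
          rw [hv0, mul_zero, zero_sub] at e1
          have := mul_right_cancel₀ hv1 (show (-x) * v 1 = lam * v 1 by rw [← e1]; ring)
          exact this.symm
        rw [hlam, map_neg, hxσ]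
      · -- `ρ = v₀ ∕ v₁` is skew, `λ = c ρ − x`
        have hρ : σ (v 0 / v 1) = -(v 0 / v 1) := by
          have hσv1 : σ (v 1) ≠ 0 := (map_ne_zero σ).2 hv1
          rw [map_div₀]
          field_simp
          linear_combination hiso
        have hlam : lam = X 1 0 * (v 0 / v 1) - x := by
          rw [eq_sub_iff_add_eq, div_eq_mul_inv, ← mul_assoc, ← mul_inv_cancel_right₀ hv1 (lam + x), add_mul]
          congr 1
          linear_combination e1.symm
        rw [hlam, map_sub, map_mul, hc, hρ, hxσ]
        ring
  · -- `λ² v = Z² v = δ v`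
    have hsq := traceless_sq_mulVec x (X 0 1) (X 1 0) v
    rw [hZ, Matrix.mulVec_smul, hZ, smul_smul] at hsq
    obtain ⟨i, hi⟩ : ∃ i, v i ≠ 0 := Function.ne_iff.1 hv
    have := congr_fun hsq i
    simp only [Pi.smul_apply, smul_eq_mul] at this
    have := mul_right_cancel₀ hi this
    rw [← this]; ring

end Algebra

/-! ## §2 The bridge: compact centraliser ⇒ no isotropic eigen-line -/

section Bridge

variable {F K : Type*} [Field F] [Field K] [ValuativeRel K] [TopologicalSpace K] [IsNonarchimedeanLocalField K]
  (ι : F →+* K) (σ : K →+* K) (hσ : ∀ x, σ (σ x) = x) (hσι : ∀ x : F, σ (ι x) = ι x)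
  (hfix : ∀ z : K, σ z = z → ∃ x : F, ι x = z) {α : K} (hα : σ α = -α) (hα0 : α ≠ 0) (h2 : (2 : K) ≠ 0)

/-- `|sⁿ| ≤ |sⁿ + s⁻ⁿ|` for `|s| > 1`, `n ≥ 1` (ultrametric inequality ★ `normAbs_add_le_max`). [folklore] -/
theorem pow_normAbs_le_normAbs_pow_add_inv {s : K} (hs : 1 < normAbs K s) {n : ℕ} (hn : n ≠ 0) :
    normAbs K s ^ n ≤ normAbs K (s ^ n + (s ^ n)⁻¹) := by
  have hlt : normAbs K ((s ^ n)⁻¹) < normAbs K s ^ n := by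
    rw [map_inv₀, map_pow]
    have h1 : 1 < normAbs K s ^ n := one_lt_pow₀ hs hn
    exact (inv_lt_one_of_one_lt₀ h1).trans h1
  have hle : normAbs K (s ^ n) ≤ max (normAbs K (s ^ n + (s ^ n)⁻¹)) (normAbs K (-(s ^ n)⁻¹)) := by
    have := normAbs_add_le_max (s ^ n + (s ^ n)⁻¹) (-(s ^ n)⁻¹)
    rwa [add_neg_cancel_right] at this
  rw [normAbs_neg, map_pow] at hle
  rcases le_max_iff.1 hle with h | h
  · exact h
  · exact absurd (lt_of_lt_of_le hlt h) (lt_irrefl _)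

include hσ hσι hfix hα hα0 h2 in
/-- **THE (E-cpt) ⇒ (E-iso) BRIDGE.**  Let `X ∈ 𝔲(σ, Φ₂)(K)` be regular (`discr χ_X ≠ 0`) with COMPACT centraliser `Z_U(X) = {g ∈ U(σ,Φ₂) : g X g⁻¹ = X}`, and let `F ⊂ K` contain some `t`
with `|ι t| > 1` (e.g. `ϖ⁻¹`).  Then `X` has NO isotropic eigen-line.  An isotropic eigenvector would make the traceless eigenvalue `λ = ι e` fixed (§1), `det W = −e²` for the
descended `W ∈ 𝔰𝔩₂(F)` (★ `exists_descent_traceless`), `W ~ diag(e, −e)` (★ `exists_gl_conj_eq_of_trace_eq_of_det_eq`), and the determinant-one `gₙ = h⁻¹ diag(tⁿ, t⁻ⁿ) h`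
lift (★ `exists_mem_unitaryGroupOfForm_conj_eq_smul_map`) to elements `uₙ ∈ Z_U(X)` with `|tr uₙ| = |ι(tⁿ + t⁻ⁿ)| ≥ |ι t|ⁿ → ∞`, while `g ↦ |tr g|` (★ `continuous_normAbs`) is
bounded on the compact `Z_U(X)`. [cite: Serre1980Trees, Ch. II §1.2–§1.3] [cite: LabesseLanglands1979, §2 p. 7] [cite: Rogawski1990, §3.6 p. 31] -/
theorem not_isotropic_eigenvector_of_isCompact_centralizer {t : F} (ht : 1 < normAbs K (ι t))
    {X : Matrix (Fin 2) (Fin 2) K} (hX : (X.map σ)ᵀ * !![(0 : K), 1; 1, 0] + !![(0 : K), 1; 1, 0] * X = 0) (hreg : X.charpoly.discr ≠ 0)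
    (hcpt : IsCompact {g : ↥(unitaryGroupOfForm σ !![(0 : K), 1; 1, 0]) |
      ((g : GL (Fin 2) K) : Matrix (Fin 2) (Fin 2) K) * X * (((g : GL (Fin 2) K) : Matrix (Fin 2) (Fin 2) K))⁻¹ = X}) :
    ∀ v : Fin 2 → K, v ≠ 0 → (∃ μ : K, X.mulVec v = μ • v) → σ (v 0) * v 1 + σ (v 1) * v 0 ≠ 0 := by
  intro v hv hμ hiso
  obtain ⟨μ, hμ⟩ := hμ
  obtain ⟨hfixed, hsq⟩ := eigenvalue_fixed_of_isotropic σ hσ h2 hX hv hμ hiso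
  obtain ⟨e, he⟩ := hfix _ hfixed
  have hδ : ((X 0 0 + σ (X 0 0)) / 2) ^ 2 + X 0 1 * X 1 0 ≠ 0 := fun h0 => hreg (by rw [discr_charpoly_eq_four_mul σ hσ h2 hX, h0, mul_zero])
  have he0 : e ≠ 0 := by
    rintro rfl
    apply hδ
    rw [← hsq, ← he, map_zero]
    ring
  have hXdec := eq_smul_one_add_traceless σ hσ h2 hX
  obtain ⟨W, hWtr, hWdet, hWeq⟩ := exists_descent_traceless ι σ hσ hfix hα hα0 hX
  have hWdet' : W.det = -e ^ 2 := by
    have h1 : ι (-W.det) = ι (e ^ 2) := by rw [hWdet, ← hsq, ← he, map_pow]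
    linear_combination (-1 : F) * ι.injective h1
  have h2F : (2 : F) ≠ 0 := fun h => h2 (by rw [← map_ofNat ι 2, h, map_zero])
  -- `W` and `diag(e, −e)` are non-scalar with equal trace and determinant
  have hWns : ∀ m : F, W ≠ m • (1 : Matrix (Fin 2) (Fin 2) F) := by
    intro m hm
    have htr : W.trace = 2 * m := by rw [hm, Matrix.trace_smul, Matrix.trace_one]; simp; ring
    have hm0 : m = 0 := by rw [hWtr] at htr; exact (mul_eq_zero.1 htr.symm).resolve_left h2F
    apply he0
    have : W.det = 0 := by rw [hm, hm0, zero_smul, Matrix.det_zero]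
    rw [hWdet'] at this
    exact pow_eq_zero_iff (n := 2) (by norm_num) |>.1 (neg_eq_zero.1 this)
  have hDns : ∀ m : F, !![e, 0; 0, -e] ≠ m • (1 : Matrix (Fin 2) (Fin 2) F) := by
    intro m hm
    have h00 := congr_fun (congr_fun hm 0) 0
    have h11 := congr_fun (congr_fun hm 1) 1
    simp at h00 h11
    have h2e : (2 : F) * e = 0 := by linear_combination h00 - h11
    exact he0 ((mul_eq_zero.1 h2e).resolve_left h2F)
  obtain ⟨h, hh⟩ := exists_gl_conj_eq_of_trace_eq_of_det_eq W !![e, 0; 0, -e] hWns hDns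
    (by rw [hWtr, Matrix.trace_fin_two_of]; ring) (by rw [hWdet', Matrix.det_fin_two_of]; ring)
  have hhW : ((h : GL (Fin 2) F) : Matrix (Fin 2) (Fin 2) F) * W = !![e, 0; 0, -e] * ((h : GL (Fin 2) F) : Matrix (Fin 2) (Fin 2) F) := by
    have := congrArg (· * ((h : GL (Fin 2) F) : Matrix (Fin 2) (Fin 2) F)) hh
    simpa only [Matrix.mul_assoc, ← Units.val_mul, inv_mul_cancel, Units.val_one, Matrix.mul_one] using this
  have hW' : W = ((h⁻¹ : GL (Fin 2) F) : Matrix (Fin 2) (Fin 2) F) * !![e, 0; 0, -e] * ((h : GL (Fin 2) F) : Matrix (Fin 2) (Fin 2) F) := by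
    rw [Matrix.mul_assoc, ← hhW, ← Matrix.mul_assoc, ← Units.val_mul, inv_mul_cancel, Units.val_one, Matrix.one_mul]
  -- the continuous function `g ↦ |tr g|` is bounded on the compact centraliser
  have hcont : Continuous fun g : ↥(unitaryGroupOfForm σ !![(0 : K), 1; 1, 0]) => normAbs K (((g : GL (Fin 2) K) : Matrix (Fin 2) (Fin 2) K)).trace :=
    LocalFieldHaar.continuous_normAbs.comp ((Units.continuous_val.comp continuous_subtype_val).matrix_trace)
  obtain ⟨B, hB⟩ := (hcpt.image hcont).bddAbove
  obtain ⟨k, hk⟩ := pow_unbounded_of_one_lt B ht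
  -- the determinant-one element `g = h⁻¹ diag(t^(k+1), t^-(k+1)) h` and its unitary lift
  have ht0 : t ≠ 0 := by
    rintro rfl
    rw [map_zero, map_zero] at ht
    exact not_lt.2 zero_le_one ht
  set T : Matrix (Fin 2) (Fin 2) F := !![t ^ (k + 1), 0; 0, (t ^ (k + 1))⁻¹] with hT
  have hTdet : T.det = 1 := by rw [hT, Matrix.det_fin_two_of, mul_zero, sub_zero, mul_inv_cancel₀ (pow_ne_zero _ ht0)]
  set g : Matrix (Fin 2) (Fin 2) F := ((h⁻¹ : GL (Fin 2) F) : Matrix (Fin 2) (Fin 2) F) * T * ((h : GL (Fin 2) F) : Matrix (Fin 2) (Fin 2) F) with hg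
  have hgdet : g.det = 1 := by rw [hg, Matrix.det_units_conj', hTdet]
  have hgtr : g.trace = t ^ (k + 1) + (t ^ (k + 1))⁻¹ := by rw [hg, Matrix.trace_units_conj', hT, Matrix.trace_fin_two_of]
  have hgW : g * W = W * g := by
    have hTD : T * !![e, 0; 0, -e] = !![e, 0; 0, -e] * T := by
      rw [hT]; ext i j; fin_cases i <;> fin_cases j <;> simp [Matrix.mul_apply] <;> ring
    rw [hW', hg]
    simp only [Matrix.mul_assoc]
    rw [← Matrix.mul_assoc ((h : GL (Fin 2) F) : Matrix (Fin 2) (Fin 2) F) (((h⁻¹ : GL (Fin 2) F) : Matrix (Fin 2) (Fin 2) F)), ← Units.val_mul, mul_inv_cancel,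
      Units.val_one, Matrix.one_mul, ← Matrix.mul_assoc ((h : GL (Fin 2) F) : Matrix (Fin 2) (Fin 2) F) (((h⁻¹ : GL (Fin 2) F) : Matrix (Fin 2) (Fin 2) F)),
      ← Units.val_mul, mul_inv_cancel, Units.val_one, Matrix.one_mul, ← Matrix.mul_assoc T, hTD, Matrix.mul_assoc]
  have hgU : IsUnit g := (Matrix.isUnit_iff_isUnit_det g).2 (by rw [hgdet]; exact isUnit_one)
  obtain ⟨u, hu⟩ := exists_mem_unitaryGroupOfForm_conj_eq_smul_map ι σ hσι hα hα0 (s := 1) (g := hgU.unit)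
    (by rw [IsUnit.unit_spec, hgdet, map_one, map_one, mul_one, mul_one])
  rw [IsUnit.unit_spec, one_smul] at hu
  have hDD' := diagonal_mul_diagonal_inv (E := K) hα0
  have hD'D := diagonal_inv_mul_diagonal (E := K) hα0
  set uM : Matrix (Fin 2) (Fin 2) K := ((u : GL (Fin 2) K) : Matrix (Fin 2) (Fin 2) K) with huM
  have huM' : uM = Matrix.diagonal ![(1 : K), α⁻¹] * g.map ι * Matrix.diagonal ![(1 : K), α] := by
    rw [← hu, ← Matrix.mul_assoc, ← Matrix.mul_assoc, hD'D, Matrix.one_mul, Matrix.mul_assoc, hD'D, Matrix.mul_one]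
  have hZ : !![(X 0 0 + σ (X 0 0)) / 2, X 0 1; X 1 0, -((X 0 0 + σ (X 0 0)) / 2)] =
      Matrix.diagonal ![(1 : K), α⁻¹] * W.map ι * Matrix.diagonal ![(1 : K), α] := by
    rw [← hWeq, ← Matrix.mul_assoc, ← Matrix.mul_assoc, hD'D, Matrix.one_mul, Matrix.mul_assoc, hD'D, Matrix.mul_one]
  have hmap : g.map ι * W.map ι = W.map ι * g.map ι := by rw [← Matrix.map_mul, hgW, Matrix.map_mul]
  -- `u` centralises the traceless part, hence `X`
  have hcommZ : uM * !![(X 0 0 + σ (X 0 0)) / 2, X 0 1; X 1 0, -((X 0 0 + σ (X 0 0)) / 2)] =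
      !![(X 0 0 + σ (X 0 0)) / 2, X 0 1; X 1 0, -((X 0 0 + σ (X 0 0)) / 2)] * uM := by
    rw [huM', hZ]
    calc Matrix.diagonal ![(1 : K), α⁻¹] * g.map ι * Matrix.diagonal ![(1 : K), α] *
          (Matrix.diagonal ![(1 : K), α⁻¹] * W.map ι * Matrix.diagonal ![(1 : K), α])
        = Matrix.diagonal ![(1 : K), α⁻¹] * (g.map ι * ((Matrix.diagonal ![(1 : K), α] * Matrix.diagonal ![(1 : K), α⁻¹]) * W.map ι)) *
            Matrix.diagonal ![(1 : K), α] := by simp only [Matrix.mul_assoc]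
      _ = Matrix.diagonal ![(1 : K), α⁻¹] * (W.map ι * ((Matrix.diagonal ![(1 : K), α] * Matrix.diagonal ![(1 : K), α⁻¹]) * g.map ι)) *
            Matrix.diagonal ![(1 : K), α] := by rw [hDD', Matrix.one_mul, Matrix.one_mul, hmap]
      _ = Matrix.diagonal ![(1 : K), α⁻¹] * W.map ι * Matrix.diagonal ![(1 : K), α] *
            (Matrix.diagonal ![(1 : K), α⁻¹] * g.map ι * Matrix.diagonal ![(1 : K), α]) := by simp only [Matrix.mul_assoc]
  have huX : uM * X = X * uM := by
    conv_lhs => rw [hXdec]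
    conv_rhs => rw [hXdec]
    rw [Matrix.mul_add, Matrix.add_mul, Matrix.mul_smul, Matrix.mul_one, Matrix.smul_mul, Matrix.one_mul, hcommZ]
  have hmem : u ∈ {g : ↥(unitaryGroupOfForm σ !![(0 : K), 1; 1, 0]) |
      ((g : GL (Fin 2) K) : Matrix (Fin 2) (Fin 2) K) * X * (((g : GL (Fin 2) K) : Matrix (Fin 2) (Fin 2) K))⁻¹ = X} := by
    show uM * X * uM⁻¹ = X
    rw [huX, Matrix.mul_nonsing_inv_cancel_right _ _ (Matrix.isUnits_det_units (u : GL (Fin 2) K))]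
  -- the trace of `u` is `ι(t^(k+1) + t^-(k+1))`, too large
  have htr : uM.trace = ι (t ^ (k + 1) + (t ^ (k + 1))⁻¹) := by
    rw [huM', Matrix.trace_mul_cycle, hDD', Matrix.one_mul, Matrix.trace_fin_two, Matrix.map_apply, Matrix.map_apply, ← map_add,
      ← Matrix.trace_fin_two, hgtr]
  have hle : normAbs K (ι t) ^ (k + 1) ≤ normAbs K uM.trace := by
    rw [htr, map_add, map_inv₀, map_pow]
    exact pow_normAbs_le_normAbs_pow_add_inv (K := K) ht (Nat.succ_ne_zero k)
  have hbd : normAbs K uM.trace ≤ B := hB ⟨u, hmem, rfl⟩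
  have hlt : B < normAbs K (ι t) ^ (k + 1) := hk.trans_le (pow_le_pow_right₀ ht.le (Nat.le_succ k))
  exact absurd (hle.trans hbd) (not_le.2 hlt)

include hσ hσι hfix hα hα0 h2 in
open scoped Classical in
/-- **(E4-fin) WITH THE LETTER'S (E-cpt) INPUT**: ★ `exists_fin_compactCartan_representatives` (p857087) composed with the bridge — every regular `X ∈ 𝔲(σ, J)` (`J = Φ₂`) with
COMPACT centraliser is `U(σ, J)`-conjugate to `a·1 + b·Y_i` for one of finitely many representatives `Y_i` (regular, without isotropic eigen-line), `a` skew, `b` fixed.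
[cite: Serre1980Trees, Ch. II §1.2–§1.3] [cite: LabesseLanglands1979, §2 p. 7] [cite: Rogawski1990, §3.6 p. 31] -/
theorem exists_fin_compactCartan_representatives_of_isCompact {t : F} (ht : 1 < normAbs K (ι t))
    {J : Matrix (Fin 2) (Fin 2) K} (hJ : J = (StdForm.antidiagonal 2).over K)
    (R : Finset F) (hR : ∀ d : F, d ≠ 0 → ∃ r ∈ R, ∃ f : F, f ≠ 0 ∧ d = r * f ^ 2) :
    ∃ (n : ℕ) (Y : Fin n → Matrix (Fin 2) (Fin 2) K),
      (∀ i, ((Y i).map σ)ᵀ * J + J * Y i = 0 ∧ (Y i).charpoly.discr ≠ 0 ∧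
        ∀ v : Fin 2 → K, v ≠ 0 → (∃ μ : K, (Y i).mulVec v = μ • v) → σ (v 0) * v 1 + σ (v 1) * v 0 ≠ 0) ∧
      ∀ X : Matrix (Fin 2) (Fin 2) K, (X.map σ)ᵀ * J + J * X = 0 → X.charpoly.discr ≠ 0 →
        IsCompact {g : ↥(unitaryGroupOfForm σ J) | ((g : GL (Fin 2) K) : Matrix (Fin 2) (Fin 2) K) * X * (((g : GL (Fin 2) K) : Matrix (Fin 2) (Fin 2) K))⁻¹ = X} →
        ∃ (i : Fin n) (g : ↥(unitaryGroupOfForm σ J)) (a b : K), σ a = -a ∧ σ b = b ∧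
          ((g : GL (Fin 2) K) : Matrix (Fin 2) (Fin 2) K) * X * (((g : GL (Fin 2) K) : Matrix (Fin 2) (Fin 2) K))⁻¹ =
            a • (1 : Matrix (Fin 2) (Fin 2) K) + b • Y i := by
  obtain ⟨n, Y, hY, hall⟩ := exists_fin_compactCartan_representatives ι σ hσ hσι hfix hα hα0 h2 hJ R hR
  obtain rfl : J = !![(0 : K), 1; 1, 0] := hJ.trans (by ext i j; fin_cases i <;> fin_cases j <;> simp [StdForm.over, StdForm.antidiagonal_J_apply, Fin.rev])
  exact ⟨n, Y, hY, fun X hX hreg hcpt => hall X hX hreg (not_isotropic_eigenvector_of_isCompact_centralizer ι σ hσ hσι hfix hα hα0 h2 ht hX hreg hcpt)⟩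

end Bridge

end Summit.HodgeConjecture.HodgeConjecture.Cruxes.H413.K2E3U2CompactCentraliserIsotropic

end
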